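/-
Copyright: the b2b-balaban T⁴-continuum CRUX team, row NE7b OWNER lineage `t4-ne7b-p1` (gen 124). Project licence.
-/
import Summits.QuantumFields.BalabanUV.T4Continuum.Spine.NE7b.SupZdPerturbedDecay

/-!
# THE `H + K` COARSE COLUMN ON `ℤ^d`, FIRST BRICKS: for `V : ℤ^d → [−λ, Λ]` (`d ≥ 3`, every mesh) and a kernel `|K(p,q)| ≤ εe^{−γ|p − q|₁}`
# small in the sense of (213) and of (215)'s profile contraction `θ = (C_PK_{δ₀−μ})·εe^{μd}K_{γ−μ} ≤ 1∕2` (`0 < μ < min(δ₀, γ)`):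
# (§1) the PERTURBED PROFILE LEMMA without rate loss — every bounded solution of `(H_V + K)u = f` with `|f(p)| ≤ Me^{−μ|blk n p − b₀|₁}`
# obeys `|u(p)| ≤ 2C_PK_{δ₀−μ}Me^{−μ|blk n p − b₀|₁}` ((215) stated block-supported sources; same proof); (§2) the PERTURBED BLOCK COLUMNS
# `Ψ^K_{b′}` (bounded solutions of `(H_V + K)Ψ = 𝟙_{B n b′}`) EXIST, are UNIQUE, decay like `2C_PK_{δ₀−μ}e^{−μ|blk n p − b′|₁}`, their block
# means — the perturbed coarse entries `T_K(b,b′) = (n+1)^{−d}Σ_{q∈B n b}Ψ^K_{b′}(q)` — decay like `2C_PK_{δ₀−μ}e^{−μ|b − b′|₁}`, and BOTH are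
# LIPSCHITZ IN `K`: `|Ψ^K_{b′} − Ψ_{b′}| ≤ 4C_PK_{δ₀−μ}θe^{−μ|blk n p − b′|₁}`, `|T_K(b,b′) − T(b,b′)| ≤ 4C_PK_{δ₀−μ}θe^{−μ|b − b′|₁}` (`θ ∝ ε`);
# constants from `(d, a, λ, Λ)` ONLY (row NE7b, node U5c; (213)∕(214)∕(215)∕(188) BY NAME; [folklore])

Cell `pub-balaban`, sub-cell `t4`, spine estimate NE7b (`T4WeightBudget.RelWeightBound`; the cell's OWN estimate — NOT PRINTED in
[Bałaban 1983–89], NOT PROVED).  Crux-route work under `Spine/NE7b/` by the row OWNER (`t4-ne7b-p1` gen 124, file (216)) under FREEZE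
(0)'s crux-prover clause; NOTHING of Bałaban's is named as a Lean object, valued or asserted; no `T4Continuum/Support` leaf typed; no `def`,
no notation (`Ψ^K_{b′}`, `T_K(b,b′)`, `θ` WRITTEN OUT); zero `sorry`.  Imports (BY NAME): the OWNER's (215) `…SupZdPerturbedDecay`
(`kernel_profile_step`, `neumann_iterates_profile`, `neumann_series_solves`; through it (213) `zd_perturbed_inverse_clm`, (214)
`zd_profile_noLoss`, (203) `kernel_clm`, (188) `exists_zd_propagator_clm`, (48) `abs_apply_le_norm`, (27) `mem_B`, `sum_B_const`), Mathlib's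
`Summable.tsum_sub`, `Finset.abs_sum_le_sum_abs`, `Finset.sum_sub_distrib`.

WHY (located).  § [NE7bP1-G124-HANDOFF] NEXT (3)(a), `H + K` half: after (213) (existence∕uniqueness on `ℓ^∞(ℤ^d)`) and (215) (decay of
the perturbed block columns) the next object is the PERTURBED COARSE OPERATOR `T_K = Q′G_KQ′*` on the block lattice `ℤ^d` and its inverse.
This file supplies what a perturbation argument AROUND (194)'s `M = T⁻¹` needs: `T_K`'s entries are well defined (uniqueness of the bounded
block columns), decay exponentially on the block scale, and `T_K − T` is `O(ε)` with the same exponential decay — so `T_K = T + E_K` with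
`|E_K(b,b′)| ≤ 4C_PK_{δ₀−μ}θe^{−μ|b−b′|₁}`, and `T_K⁻¹ = (1 + ME_K)⁻¹M` is a Neumann series in the algebra of exponentially decaying block
kernels ((205)'s convolution bounds) once `θ` is small against (195)'s decay constant of `M` — no floor, no `ℓ²`, no torus needed.  The
Lipschitz estimate is the resolvent identity made pointwise: `(H_V + K)(Ψ^K − Ψ) = −KΨ`, the source `−KΨ` has profile
`εe^{μd}K_{γ−μ}·2C_PK_{δ₀−μ}` by (215)'s kernel step applied to `Ψ`'s profile ((ii) with the zero kernel, which is in the class), and §1 —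
(215)'s theorem for PROFILE sources (the proof is (215)'s §4 with the profile hypothesis in place of block support) — returns the profile
with the factor `2C_PK_{δ₀−μ}`.

WHAT IS PROVED ([folklore]): §1 **`zd_perturbed_profile`** (`∃ C₀ C_P δ₀ > 0`: for ALL `n, V, ε, γ, μ` as above and every `K` of the class —
(213)'s `G_K` with its equation and uniqueness clause, AND the no-loss profile bound for every profile source and bounded solution);
§2 **`zd_perturbed_coarse_entries`** (THE END: same constants; (i) existence + uniqueness of the bounded perturbed block columns, (ii) their
decay and the decay of the perturbed coarse entries, (iii) Lipschitz dependence on `K` of both, constant `4C_PK_{δ₀−μ}θ`); §3 toy.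

HONEST (what this is NOT).  Entries only: the perturbed coarse operator's INVERSE on `ℤ^d` (Neumann around (194)'s `M`, or (194)'s section
method with a floor) and the torus → `ℤ^d` limit for `H + K` are the sequel; TWO smallness conditions with the sup road's constants — NOT
(163)'s energy threshold; symmetry of `K` unused (so `T_K` is not claimed symmetric); the LINEAR column only; `d ≥ 3` only; scalar
skeleton ((A3), NC-NE7b-α UNRULED); nothing of the covariant propagators of [B4]–[B6]; nothing of Bałaban's asserted.  BY-NAME EFFECT ON
THE WALL: NONE.  NE7b NOT PRINTED ∕ NOT PROVED; spine PROVED 0∕9; rung (B)+1 — the programme's measures remain FINITE-torus statements;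
NOT the mass gap, NOT Clay.  HONEST DEPENDENCY: continuum YM on T⁴ ⇐ BetaPertH ∧ nine spine estimates (0∕9 proved); BetaPertH ⇐ (D1) ∧
(D4) ∧ CAP+tail; G-an2-4 gates asym, D1 and NE2∕3∕4.
-/

set_option autoImplicit false

noncomputable section

namespace Summit.QuantumFields.BalabanUV.T4Continuum.NE7b.SupZdPerturbedCoarseEntries

open Real Filter Topology
open scoped ENNReal
open Literature.MathematicalPhysics.QuantumFieldTheory.Balaban1983to89
open B6QGQLower276 (X e blk B side chart mem_B sum_B sum_B_const card_cube blk_chart)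
open SupZdCoarseInverseOperator (kernel_clm)
open SupZdPropagatorOperator (exists_zd_propagator_clm)
open SupZdPerturbedOperator (zd_perturbed_inverse_clm)
open SupZdProfileNoLoss (zd_profile_noLoss)
open SupZdPerturbedDecay (kernel_profile_step neumann_iterates_profile neumann_series_solves)
open OneShotChartSupOperator (abs_apply_le_norm)

variable {d : ℕ}

/-! ## §1. The perturbed profile lemma: sources of exponential block profile -/

/-- **THE PERTURBED PROFILE LEMMA (no rate loss)**: `d ≥ 3`, `a > 0`, `λ < min(2,a)`, `Λ ≥ 0` ⟹ `∃ C₀ C_P δ₀ > 0` (from `(d, a, λ, Λ)`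
ONLY) such that for ALL `n`, `V : ℤ^d → [−λ, Λ]`, `ε ≥ 0`, `0 < μ < min(δ₀, γ)`, under the two smallness conditions of (215), every kernel
`|K(p,q)| ≤ εe^{−γ|p−q|₁}`, every source of PROFILE `|f(p)| ≤ Me^{−μ|blk n p − b₀|₁}` and EVERY bounded solution `u` of
`H_Vu + Σ′_qK(·,q)u(q) = f`: `|u(p)| ≤ 2C_PK_{δ₀−μ}·M·e^{−μ|blk n p − b₀|₁}` — (215)'s proof verbatim for profile sources ((215) stated the
block-supported case): Neumann iterates keep the profile ((215), §2 on (214)), their series solves ((215), §3), uniqueness ((213)). [folklore] -/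
theorem zd_perturbed_profile (hd : 3 ≤ d) (a : ℝ) (ha : 0 < a) {lam Lam : ℝ} (hlam : lam < min 2 a) (hLam : 0 ≤ Lam) :
    ∃ C₀ CP δ₀ : ℝ, 0 < C₀ ∧ 0 < CP ∧ 0 < δ₀ ∧ ∀ (n : ℕ) (V : X d → ℝ), (∀ p, -lam ≤ V p) → (∀ p, V p ≤ Lam) →
      ∀ (ε γ μ : ℝ), 0 ≤ ε → 0 < μ → μ < δ₀ → μ < γ →
      ε * (2 * (1 - exp (-γ))⁻¹) ^ d * C₀ ≤ 1 / 2 →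
      (CP * (2 * (1 - exp (-(δ₀ - μ)))⁻¹) ^ d) * (ε * exp (μ * d) * (2 * (1 - exp (-(γ - μ)))⁻¹) ^ d) ≤ 1 / 2 →
      ∀ (K : X d → X d → ℝ), (∀ p q, |K p q| ≤ ε * exp (-(γ * ∑ i, (((p i - q i).natAbs : ℕ) : ℝ)))) →
      (∃ GK : lp (fun _ : X d => ℝ) ∞ →L[ℝ] lp (fun _ : X d => ℝ) ∞,
        (∀ (f : lp (fun _ : X d => ℝ) ∞) (p : X d),
          ((n : ℝ) + 1) ^ 2 * ∑ μ', (2 * GK f p - GK f (p + e μ') - GK f (p - e μ'))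
            + a / ((n : ℝ) + 1) ^ d * ∑ q ∈ B n (blk n p), GK f q + V p * GK f p + ∑' q : X d, K p q * GK f q = f p) ∧
        (∀ (f : lp (fun _ : X d => ℝ) ∞) (u : X d → ℝ) (Bu : ℝ), (∀ p, |u p| ≤ Bu) →
          (∀ p, ((n : ℝ) + 1) ^ 2 * ∑ μ', (2 * u p - u (p + e μ') - u (p - e μ'))
            + a / ((n : ℝ) + 1) ^ d * ∑ q ∈ B n (blk n p), u q + V p * u p + ∑' q : X d, K p q * u q = f p) →
          ∀ p, u p = GK f p)) ∧
      ∀ (b₀ : X d) (M : ℝ) (f : X d → ℝ), (∀ p, |f p| ≤ M * exp (-(μ * ∑ i, (((blk n p i - b₀ i).natAbs : ℕ) : ℝ)))) →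
      ∀ (u : X d → ℝ) (Bu : ℝ), (∀ p, |u p| ≤ Bu) →
      (∀ p, ((n : ℝ) + 1) ^ 2 * ∑ μ', (2 * u p - u (p + e μ') - u (p - e μ'))
        + a / ((n : ℝ) + 1) ^ d * ∑ q ∈ B n (blk n p), u q + V p * u p + ∑' q : X d, K p q * u q = f p) →
      ∀ p, |u p| ≤ 2 * (CP * (2 * (1 - exp (-(δ₀ - μ)))⁻¹) ^ d) * M * exp (-(μ * ∑ i, (((blk n p i - b₀ i).natAbs : ℕ) : ℝ))) := by
  classical
  obtain ⟨C₀, hC₀, H213⟩ := zd_perturbed_inverse_clm (d := d) hd a ha hlam hLam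
  obtain ⟨CP, δ₀, hCP, hδ₀, H214⟩ := zd_profile_noLoss (d := d) hd a ha hlam hLam
  obtain ⟨Cg, hCg, H188⟩ := exists_zd_propagator_clm (d := d) hd a ha hlam hLam
  refine ⟨C₀, CP, δ₀, hC₀, hCP, hδ₀, ?_⟩
  intro n V hV hV' ε γ μ hε hμ hμδ hμγ hsmall1 hsmall2 K hK
  have hγ : 0 < γ := lt_trans hμ hμγ
  obtain ⟨GK, -, hGKeq, hGKuniq⟩ := H213 n V hV hV' ε γ hε hγ hsmall1 K hK
  refine ⟨⟨GK, hGKeq, hGKuniq⟩, ?_⟩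
  intro b₀ M f hfM u Bu huB hu p
  have hM : 0 ≤ M := by
    have h1 := (abs_nonneg _).trans (hfM p)
    exact le_of_mul_le_mul_right (by rw [zero_mul]; exact h1) (exp_pos _)
  have hKδμ : 0 < (2 * (1 - exp (-(δ₀ - μ)))⁻¹) ^ d := pow_pos (mul_pos two_pos (inv_pos.2 (sub_pos.2 (exp_lt_one_iff.2 (by linarith))))) d
  have hKγμ : 0 < (2 * (1 - exp (-(γ - μ)))⁻¹) ^ d := pow_pos (mul_pos two_pos (inv_pos.2 (sub_pos.2 (exp_lt_one_iff.2 (by linarith))))) d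
  obtain ⟨CPK, hCPK⟩ : ∃ CPK : ℝ, CPK = CP * (2 * (1 - exp (-(δ₀ - μ)))⁻¹) ^ d := ⟨_, rfl⟩
  have hCPK0 : 0 < CPK := by rw [hCPK]; exact mul_pos hCP hKδμ
  obtain ⟨θ, hθ⟩ : ∃ θ : ℝ, θ = CPK * (ε * exp (μ * d) * (2 * (1 - exp (-(γ - μ)))⁻¹) ^ d) := ⟨_, rfl⟩
  have hθ0 : 0 ≤ θ := by rw [hθ]; exact mul_nonneg hCPK0.le (mul_nonneg (mul_nonneg hε (exp_pos _).le) hKγμ.le)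
  have hθ1 : θ ≤ 1 / 2 := by rw [hθ, hCPK]; exact hsmall2
  obtain ⟨G, -, hGeq, -⟩ := H188 n V hV hV'
  obtain ⟨Kop, -, hKop⟩ := kernel_clm (d := d) hε hγ K hK
  -- the source as an element of `ℓ^∞` (`|f| ≤ M`), with profile `M` at rate `μ`
  have hfsup : ∀ q, |f q| ≤ M := fun q =>
    (hfM q).trans (mul_le_of_le_one_right hM (exp_le_one_iff.2 (neg_nonpos.2 (by positivity))))
  have hfmem : Memℓp f ∞ := memℓp_infty ⟨M, by
    rintro _ ⟨q, rfl⟩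
    show ‖f q‖ ≤ M
    rw [Real.norm_eq_abs]; exact hfsup q⟩
  obtain ⟨fl, hfl⟩ : ∃ fl : lp (fun _ : X d => ℝ) ∞, ∀ q, fl q = f q := ⟨⟨f, hfmem⟩, fun _ => rfl⟩
  have hfprof : ∀ q, |fl q| ≤ M * exp (-(μ * ∑ i, (((blk n q i - b₀ i).natAbs : ℕ) : ℝ))) := fun q => by rw [hfl]; exact hfM q
  -- (214) as the profile hypothesis of (215), §2
  have hprof : ∀ (Mg : ℝ) (g : lp (fun _ : X d => ℝ) ∞), (∀ q, |g q| ≤ Mg * exp (-(μ * ∑ i, (((blk n q i - b₀ i).natAbs : ℕ) : ℝ)))) →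
      ∀ q, |G g q| ≤ CPK * Mg * exp (-(μ * ∑ i, (((blk n q i - b₀ i).natAbs : ℕ) : ℝ))) := fun Mg g hg q => by
    have h := H214 n V hV hV' μ hμ hμδ b₀ Mg (fun q => g q) hg (fun q => G g q) ‖G g‖ (fun q => abs_apply_le_norm (G g) q) (hGeq g) q
    rw [hCPK]
    calc |G g q| ≤ CP * (2 * (1 - exp (-(δ₀ - μ)))⁻¹) ^ d * Mg * exp (-(μ * ∑ i, (((blk n q i - b₀ i).natAbs : ℕ) : ℝ))) := h
      _ = _ := by ring
  -- the iterates, their profile and their recursion ((215), §2)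
  obtain ⟨useq, huseq⟩ : ∃ useq : ℕ → X d → ℝ, ∀ j q, useq j q = (((-(G.comp Kop)) ^ j) (G fl)) q := ⟨_, fun _ _ => rfl⟩
  have hiter : ∀ j q, |useq j q| ≤ CPK * M * θ ^ j * exp (-(μ * ∑ i, (((blk n q i - b₀ i).natAbs : ℕ) : ℝ))) := by
    intro j q
    rw [huseq, hθ]
    exact neumann_iterates_profile n hε hμ.le hμγ K hK G Kop hKop b₀ hprof fl M hfprof j q
  have hrec0 : ∀ q, ((n : ℝ) + 1) ^ 2 * ∑ μ', (2 * useq 0 q - useq 0 (q + e μ') - useq 0 (q - e μ'))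
      + a / ((n : ℝ) + 1) ^ d * ∑ q' ∈ B n (blk n q), useq 0 q' + V q * useq 0 q = f q := by
    intro q
    have e0 : ∀ q', useq 0 q' = G fl q' := fun q' => by rw [huseq, pow_zero]; rfl
    simp only [e0]
    rw [← hfl]; exact hGeq fl q
  have hrecS : ∀ j q, ((n : ℝ) + 1) ^ 2 * ∑ μ', (2 * useq (j + 1) q - useq (j + 1) (q + e μ') - useq (j + 1) (q - e μ'))
      + a / ((n : ℝ) + 1) ^ d * ∑ q' ∈ B n (blk n q), useq (j + 1) q' + V q * useq (j + 1) q = -(∑' q' : X d, K q q' * useq j q') := by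
    intro j q
    obtain ⟨w, hw⟩ : ∃ w : lp (fun _ : X d => ℝ) ∞, w = ((-(G.comp Kop)) ^ j) (G fl) := ⟨_, rfl⟩
    have hwq : ∀ q', w q' = useq j q' := fun q' => by rw [hw, huseq]
    have eS : ∀ q', useq (j + 1) q' = -(G (Kop w) q') := fun q' => by
      rw [huseq, pow_succ', hw]
      rfl
    simp only [eS]
    have h := hGeq (Kop w) q
    rw [hKop] at h
    simp only [hwq] at h
    rw [← h]
    have e1 : ∑ μ', (2 * -(G (Kop w) q) - -(G (Kop w) (q + e μ')) - -(G (Kop w) (q - e μ')))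
        = -∑ μ', (2 * G (Kop w) q - G (Kop w) (q + e μ') - G (Kop w) (q - e μ')) := by
      rw [← Finset.sum_neg_distrib]; exact Finset.sum_congr rfl fun μ' _ => by ring
    rw [e1, Finset.sum_neg_distrib]
    ring
  -- (215), §3: the series is a bounded solution with the profile
  obtain ⟨-, hbound, heqn⟩ := neumann_series_solves n a V hε hγ hμ.le (mul_nonneg hCPK0.le hM) hθ0 hθ1 K hK b₀ f useq hiter hrec0 hrecS
  have hstarB : ∀ q, |∑' j : ℕ, useq j q| ≤ 2 * (CPK * M) := fun q =>
    (hbound q).trans (mul_le_of_le_one_right (by positivity) (exp_le_one_iff.2 (neg_nonpos.2 (by positivity))))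
  -- (213): both `u` and the series are `G_Kf`
  have hu' : ∀ q, ((n : ℝ) + 1) ^ 2 * ∑ μ', (2 * u q - u (q + e μ') - u (q - e μ'))
      + a / ((n : ℝ) + 1) ^ d * ∑ q' ∈ B n (blk n q), u q' + V q * u q + ∑' q' : X d, K q q' * u q' = fl q := fun q => by
    rw [hfl]; exact hu q
  have hstar' : ∀ q, ((n : ℝ) + 1) ^ 2 * ∑ μ', (2 * (∑' j : ℕ, useq j q) - (∑' j : ℕ, useq j (q + e μ')) - (∑' j : ℕ, useq j (q - e μ')))
      + a / ((n : ℝ) + 1) ^ d * ∑ q' ∈ B n (blk n q), (∑' j : ℕ, useq j q') + V q * (∑' j : ℕ, useq j q)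
      + ∑' q' : X d, K q q' * ∑' j : ℕ, useq j q' = fl q := fun q => by rw [hfl]; exact heqn q
  have h1 := hGKuniq fl u Bu huB hu' p
  have h2 := hGKuniq fl (fun q => ∑' j : ℕ, useq j q) (2 * (CPK * M)) hstarB hstar' p
  rw [h1, ← h2]
  calc |∑' j : ℕ, useq j p| ≤ 2 * (CPK * M) * exp (-(μ * ∑ i, (((blk n p i - b₀ i).natAbs : ℕ) : ℝ))) := hbound p
    _ = _ := by rw [hCPK]; ring

/-! ## §2. THE END: perturbed block columns on `ℤ^d` — existence, uniqueness, decay, coarse entries, Lipschitz dependence on `K` -/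

/-- **HEADLINE — THE PERTURBED BLOCK COLUMNS AND COARSE ENTRIES ON `ℤ^d`**: `d ≥ 3`, `a > 0`, `λ < min(2,a)`, `Λ ≥ 0` ⟹ `∃ C₀ C_P δ₀ > 0`
(from `(d, a, λ, Λ)` ONLY) such that for ALL `n`, `V : ℤ^d → [−λ, Λ]`, `ε ≥ 0`, `0 < μ < min(δ₀, γ)`, under the two smallness conditions
`εK_γC₀ ≤ 1∕2` and `θ := (C_PK_{δ₀−μ})·εe^{μd}K_{γ−μ} ≤ 1∕2`, and every kernel `|K(p,q)| ≤ εe^{−γ|p−q|₁}`: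
(i) for every block `b′` there is a bounded solution `Ψ^K_{b′}` of `(H_V + K)Ψ = 𝟙_{B n b′}`, and every bounded solution equals it;
(ii) every bounded solution satisfies `|Ψ(p)| ≤ 2C_PK_{δ₀−μ}e^{−μ|blk n p − b′|₁}` and its block means — the perturbed coarse entries
`T_K(b,b′) = (n+1)^{−d}Σ_{q ∈ B n b}Ψ(q)` — satisfy `|T_K(b,b′)| ≤ 2C_PK_{δ₀−μ}e^{−μ|b − b′|₁}`;
(iii) LIPSCHITZ IN `K`: for every bounded solution `Ψ` of the perturbed and `Ψ₀` of the unperturbed block equation,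
`|Ψ(p) − Ψ₀(p)| ≤ 4C_PK_{δ₀−μ}·θ·e^{−μ|blk n p − b′|₁}` and `|T_K(b,b′) − T(b,b′)| ≤ 4C_PK_{δ₀−μ}·θ·e^{−μ|b − b′|₁}` (`θ ∝ ε`) —
`Ψ − Ψ₀` is a bounded solution of the perturbed equation with source `−KΨ₀`, whose profile is `εe^{μd}K_{γ−μ}·2C_PK_{δ₀−μ}` ((215)'s kernel
step on (ii) for `K = 0`), and §1 applies.  The first bricks of the `H + K` coarse column on `ℤ^d`. [folklore] -/
theorem zd_perturbed_coarse_entries (hd : 3 ≤ d) (a : ℝ) (ha : 0 < a) {lam Lam : ℝ} (hlam : lam < min 2 a) (hLam : 0 ≤ Lam) :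
    ∃ C₀ CP δ₀ : ℝ, 0 < C₀ ∧ 0 < CP ∧ 0 < δ₀ ∧ ∀ (n : ℕ) (V : X d → ℝ), (∀ p, -lam ≤ V p) → (∀ p, V p ≤ Lam) →
      ∀ (ε γ μ : ℝ), 0 ≤ ε → 0 < μ → μ < δ₀ → μ < γ →
      ε * (2 * (1 - exp (-γ))⁻¹) ^ d * C₀ ≤ 1 / 2 →
      (CP * (2 * (1 - exp (-(δ₀ - μ)))⁻¹) ^ d) * (ε * exp (μ * d) * (2 * (1 - exp (-(γ - μ)))⁻¹) ^ d) ≤ 1 / 2 →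
      ∀ (K : X d → X d → ℝ), (∀ p q, |K p q| ≤ ε * exp (-(γ * ∑ i, (((p i - q i).natAbs : ℕ) : ℝ)))) →
        -- (i) existence and uniqueness of the bounded perturbed block columns
        (∀ b' : X d, ∃ Ψ : X d → ℝ, (∃ BΨ : ℝ, ∀ p, |Ψ p| ≤ BΨ) ∧
          (∀ p, ((n : ℝ) + 1) ^ 2 * ∑ μ', (2 * Ψ p - Ψ (p + e μ') - Ψ (p - e μ'))
            + a / ((n : ℝ) + 1) ^ d * ∑ q ∈ B n (blk n p), Ψ q + V p * Ψ p + ∑' q : X d, K p q * Ψ q = if blk n p = b' then 1 else 0) ∧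
          ∀ (Ψ' : X d → ℝ) (BΨ' : ℝ), (∀ p, |Ψ' p| ≤ BΨ') →
            (∀ p, ((n : ℝ) + 1) ^ 2 * ∑ μ', (2 * Ψ' p - Ψ' (p + e μ') - Ψ' (p - e μ'))
              + a / ((n : ℝ) + 1) ^ d * ∑ q ∈ B n (blk n p), Ψ' q + V p * Ψ' p + ∑' q : X d, K p q * Ψ' q
                = if blk n p = b' then 1 else 0) → ∀ p, Ψ' p = Ψ p) ∧
        -- (ii) decay of every bounded perturbed block column and of the perturbed coarse entries
        (∀ (b' : X d) (Ψ : X d → ℝ) (BΨ : ℝ), (∀ p, |Ψ p| ≤ BΨ) →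
          (∀ p, ((n : ℝ) + 1) ^ 2 * ∑ μ', (2 * Ψ p - Ψ (p + e μ') - Ψ (p - e μ'))
            + a / ((n : ℝ) + 1) ^ d * ∑ q ∈ B n (blk n p), Ψ q + V p * Ψ p + ∑' q : X d, K p q * Ψ q = if blk n p = b' then 1 else 0) →
          (∀ p, |Ψ p| ≤ 2 * (CP * (2 * (1 - exp (-(δ₀ - μ)))⁻¹) ^ d) * exp (-(μ * ∑ i, (((blk n p i - b' i).natAbs : ℕ) : ℝ)))) ∧
          (∀ b, |(((n : ℝ) + 1) ^ d)⁻¹ * ∑ q ∈ B n b, Ψ q|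
            ≤ 2 * (CP * (2 * (1 - exp (-(δ₀ - μ)))⁻¹) ^ d) * exp (-(μ * ∑ i, (((b i - b' i).natAbs : ℕ) : ℝ))))) ∧
        -- (iii) Lipschitz dependence on `K` of the block columns and of the coarse entries
        (∀ (b' : X d) (Ψ : X d → ℝ) (BΨ : ℝ), (∀ p, |Ψ p| ≤ BΨ) →
          (∀ p, ((n : ℝ) + 1) ^ 2 * ∑ μ', (2 * Ψ p - Ψ (p + e μ') - Ψ (p - e μ'))
            + a / ((n : ℝ) + 1) ^ d * ∑ q ∈ B n (blk n p), Ψ q + V p * Ψ p + ∑' q : X d, K p q * Ψ q = if blk n p = b' then 1 else 0) →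
          ∀ (Ψ₀ : X d → ℝ) (BΨ₀ : ℝ), (∀ p, |Ψ₀ p| ≤ BΨ₀) →
          (∀ p, ((n : ℝ) + 1) ^ 2 * ∑ μ', (2 * Ψ₀ p - Ψ₀ (p + e μ') - Ψ₀ (p - e μ'))
            + a / ((n : ℝ) + 1) ^ d * ∑ q ∈ B n (blk n p), Ψ₀ q + V p * Ψ₀ p = if blk n p = b' then 1 else 0) →
          (∀ p, |Ψ p - Ψ₀ p| ≤ 4 * (CP * (2 * (1 - exp (-(δ₀ - μ)))⁻¹) ^ d)
            * ((CP * (2 * (1 - exp (-(δ₀ - μ)))⁻¹) ^ d) * (ε * exp (μ * d) * (2 * (1 - exp (-(γ - μ)))⁻¹) ^ d))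
            * exp (-(μ * ∑ i, (((blk n p i - b' i).natAbs : ℕ) : ℝ)))) ∧
          (∀ b, |(((n : ℝ) + 1) ^ d)⁻¹ * ∑ q ∈ B n b, Ψ q - (((n : ℝ) + 1) ^ d)⁻¹ * ∑ q ∈ B n b, Ψ₀ q|
            ≤ 4 * (CP * (2 * (1 - exp (-(δ₀ - μ)))⁻¹) ^ d)
              * ((CP * (2 * (1 - exp (-(δ₀ - μ)))⁻¹) ^ d) * (ε * exp (μ * d) * (2 * (1 - exp (-(γ - μ)))⁻¹) ^ d))
              * exp (-(μ * ∑ i, (((b i - b' i).natAbs : ℕ) : ℝ))))) := by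
  classical
  obtain ⟨C₀, CP, δ₀, hC₀, hCP, hδ₀, H⟩ := zd_perturbed_profile (d := d) hd a ha hlam hLam
  refine ⟨C₀, CP, δ₀, hC₀, hCP, hδ₀, ?_⟩
  intro n V hV hV' ε γ μ hε hμ hμδ hμγ hsmall1 hsmall2 K hK
  have hγ : 0 < γ := lt_trans hμ hμγ
  have hvol : (0 : ℝ) < ((n : ℝ) + 1) ^ d := by positivity
  have hKδμ : 0 < (2 * (1 - exp (-(δ₀ - μ)))⁻¹) ^ d := pow_pos (mul_pos two_pos (inv_pos.2 (sub_pos.2 (exp_lt_one_iff.2 (by linarith))))) d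
  have hKγμ : 0 < (2 * (1 - exp (-(γ - μ)))⁻¹) ^ d := pow_pos (mul_pos two_pos (inv_pos.2 (sub_pos.2 (exp_lt_one_iff.2 (by linarith))))) d
  obtain ⟨CPK, hCPK⟩ : ∃ CPK : ℝ, CPK = CP * (2 * (1 - exp (-(δ₀ - μ)))⁻¹) ^ d := ⟨_, rfl⟩
  have hCPK0 : 0 < CPK := by rw [hCPK]; exact mul_pos hCP hKδμ
  rw [← hCPK]
  obtain ⟨⟨GK, hGKeq, hGKuniq⟩, HK⟩ := H n V hV hV' ε γ μ hε hμ hμδ hμγ hsmall1 hsmall2 K hK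
  -- the ZERO kernel is in the class too: §1 for the unperturbed equation, same constants
  have hK0 : ∀ p q : X d, |(0 : ℝ)| ≤ ε * exp (-(γ * ∑ i, (((p i - q i).natAbs : ℕ) : ℝ))) := fun p q => by
    rw [abs_zero]; positivity
  obtain ⟨-, H0⟩ := H n V hV hV' ε γ μ hε hμ hμδ hμγ hsmall1 hsmall2 (fun _ _ => 0) hK0
  -- the block indicator has profile `1` at rate `μ` about `b′`
  have hind : ∀ (b' p : X d), |(if blk n p = b' then (1 : ℝ) else 0)| ≤ 1 * exp (-(μ * ∑ i, (((blk n p i - b' i).natAbs : ℕ) : ℝ))) := by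
    intro b' p
    split_ifs with h
    · rw [h]; simp
    · rw [abs_zero]; positivity
  -- block means of a profile
  have hmean : ∀ (b b' : X d) (A : ℝ) (Φ : X d → ℝ), (∀ p, |Φ p| ≤ A * exp (-(μ * ∑ i, (((blk n p i - b' i).natAbs : ℕ) : ℝ)))) →
      |(((n : ℝ) + 1) ^ d)⁻¹ * ∑ q ∈ B n b, Φ q| ≤ A * exp (-(μ * ∑ i, (((b i - b' i).natAbs : ℕ) : ℝ))) := by
    intro b b' A Φ hΦ
    rw [abs_mul, abs_inv, abs_of_pos hvol, inv_mul_le_iff₀ hvol]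
    calc |∑ q ∈ B n b, Φ q| ≤ ∑ q ∈ B n b, |Φ q| := Finset.abs_sum_le_sum_abs _ _
      _ ≤ ∑ _q ∈ B n b, A * exp (-(μ * ∑ i, (((b i - b' i).natAbs : ℕ) : ℝ))) :=
          Finset.sum_le_sum fun q hq => by have h := hΦ q; rw [mem_B.1 hq] at h; exact h
      _ = _ := sum_B_const _ _
  -- (ii) for the class (used by (i)'s bound as well)
  have hdec : ∀ (b' : X d) (Ψ : X d → ℝ) (BΨ : ℝ), (∀ p, |Ψ p| ≤ BΨ) →
      (∀ p, ((n : ℝ) + 1) ^ 2 * ∑ μ', (2 * Ψ p - Ψ (p + e μ') - Ψ (p - e μ'))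
        + a / ((n : ℝ) + 1) ^ d * ∑ q ∈ B n (blk n p), Ψ q + V p * Ψ p + ∑' q : X d, K p q * Ψ q = if blk n p = b' then 1 else 0) →
      ∀ p, |Ψ p| ≤ 2 * CPK * exp (-(μ * ∑ i, (((blk n p i - b' i).natAbs : ℕ) : ℝ))) := by
    intro b' Ψ BΨ hΨB hΨ p
    have h := HK b' 1 (fun q => if blk n q = b' then (1 : ℝ) else 0) (hind b') Ψ BΨ hΨB hΨ p
    rw [← hCPK, mul_one] at h
    exact h
  refine ⟨fun b' => ?_, fun b' Ψ BΨ hΨB hΨ => ⟨hdec b' Ψ BΨ hΨB hΨ, fun b => hmean b b' _ Ψ (hdec b' Ψ BΨ hΨB hΨ)⟩,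
    fun b' Ψ BΨ hΨB hΨ Ψ₀ BΨ₀ hΨ₀B hΨ₀ => ?_⟩
  · -- (i): `Ψ = G_K𝟙_{B n b′}` ((213)), unique among bounded solutions
    have hmem : Memℓp (fun p : X d => if blk n p = b' then (1 : ℝ) else 0) ∞ := memℓp_infty ⟨1, by
      rintro _ ⟨q, rfl⟩
      show ‖(if blk n q = b' then (1 : ℝ) else 0)‖ ≤ 1
      split_ifs <;> simp⟩
    obtain ⟨fl, hfl⟩ : ∃ fl : lp (fun _ : X d => ℝ) ∞, ∀ q, fl q = if blk n q = b' then (1 : ℝ) else 0 := ⟨⟨_, hmem⟩, fun _ => rfl⟩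
    refine ⟨fun p => GK fl p, ⟨‖GK fl‖, fun p => abs_apply_le_norm (GK fl) p⟩, fun p => ?_, fun Ψ' BΨ' hΨ'B hΨ' p => ?_⟩
    · rw [← hfl]; exact hGKeq fl p
    · exact hGKuniq fl Ψ' BΨ' hΨ'B (fun q => by rw [hfl]; exact hΨ' q) p
  · -- (iii): `w = Ψ − Ψ₀` solves the perturbed equation with source `−KΨ₀`
    have hΨ₀' : ∀ p, ((n : ℝ) + 1) ^ 2 * ∑ μ', (2 * Ψ₀ p - Ψ₀ (p + e μ') - Ψ₀ (p - e μ'))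
        + a / ((n : ℝ) + 1) ^ d * ∑ q ∈ B n (blk n p), Ψ₀ q + V p * Ψ₀ p + ∑' q : X d, (0 : ℝ) * Ψ₀ q
          = if blk n p = b' then 1 else 0 := fun p => by
      simp only [zero_mul, tsum_zero, add_zero]; exact hΨ₀ p
    have hdec0 : ∀ p, |Ψ₀ p| ≤ 2 * CPK * exp (-(μ * ∑ i, (((blk n p i - b' i).natAbs : ℕ) : ℝ))) := by
      intro p
      have h := H0 b' 1 (fun q => if blk n q = b' then (1 : ℝ) else 0) (hind b') Ψ₀ BΨ₀ hΨ₀B hΨ₀' p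
      rw [← hCPK, mul_one] at h
      exact h
    have hdecK := hdec b' Ψ BΨ hΨB hΨ
    -- the source `−KΨ₀` and its profile ((215)'s kernel step)
    have hstep0 := fun p => kernel_profile_step (d := d) n hε hμ.le hμγ K hK b' Ψ₀ hdec0 p
    have hstepK := fun p => kernel_profile_step (d := d) n hε hμ.le hμγ K hK b' Ψ hdecK p
    have hsrc : ∀ p, |-(∑' q : X d, K p q * Ψ₀ q)|
        ≤ ε * exp (μ * d) * (2 * (1 - exp (-(γ - μ)))⁻¹) ^ d * (2 * CPK) * exp (-(μ * ∑ i, (((blk n p i - b' i).natAbs : ℕ) : ℝ))) :=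
      fun p => by rw [abs_neg]; exact (hstep0 p).2
    -- the equation for `w`
    have hw : ∀ p, ((n : ℝ) + 1) ^ 2 * ∑ μ', (2 * (Ψ p - Ψ₀ p) - (Ψ (p + e μ') - Ψ₀ (p + e μ')) - (Ψ (p - e μ') - Ψ₀ (p - e μ')))
        + a / ((n : ℝ) + 1) ^ d * ∑ q ∈ B n (blk n p), (Ψ q - Ψ₀ q) + V p * (Ψ p - Ψ₀ p) + ∑' q : X d, K p q * (Ψ q - Ψ₀ q)
          = -(∑' q : X d, K p q * Ψ₀ q) := by
      intro p
      have e1 : ∑' q : X d, K p q * (Ψ q - Ψ₀ q) = ∑' q : X d, K p q * Ψ q - ∑' q : X d, K p q * Ψ₀ q := by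
        rw [← (hstepK p).1.tsum_sub (hstep0 p).1]; exact tsum_congr fun q => by ring
      have e2 : ∑ μ', (2 * (Ψ p - Ψ₀ p) - (Ψ (p + e μ') - Ψ₀ (p + e μ')) - (Ψ (p - e μ') - Ψ₀ (p - e μ')))
          = ∑ μ', (2 * Ψ p - Ψ (p + e μ') - Ψ (p - e μ')) - ∑ μ', (2 * Ψ₀ p - Ψ₀ (p + e μ') - Ψ₀ (p - e μ')) := by
        rw [← Finset.sum_sub_distrib]; exact Finset.sum_congr rfl fun μ' _ => by ring
      have e3 : ∑ q ∈ B n (blk n p), (Ψ q - Ψ₀ q) = ∑ q ∈ B n (blk n p), Ψ q - ∑ q ∈ B n (blk n p), Ψ₀ q := Finset.sum_sub_distrib _ _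
      rw [e1, e2, e3]
      have h1 := hΨ p
      have h2 := hΨ₀ p
      linear_combination h1 - h2
    have hwB : ∀ p, |Ψ p - Ψ₀ p| ≤ BΨ + BΨ₀ := fun p => (abs_sub _ _).trans (add_le_add (hΨB p) (hΨ₀B p))
    -- §1 for `w`
    have hwdec : ∀ p, |Ψ p - Ψ₀ p| ≤ 4 * CPK * (CPK * (ε * exp (μ * d) * (2 * (1 - exp (-(γ - μ)))⁻¹) ^ d))
        * exp (-(μ * ∑ i, (((blk n p i - b' i).natAbs : ℕ) : ℝ))) := by
      intro p
      have h := HK b' _ (fun p => -(∑' q : X d, K p q * Ψ₀ q)) hsrc (fun p => Ψ p - Ψ₀ p) (BΨ + BΨ₀) hwB hw p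
      rw [← hCPK] at h
      calc |Ψ p - Ψ₀ p| ≤ 2 * CPK * (ε * exp (μ * d) * (2 * (1 - exp (-(γ - μ)))⁻¹) ^ d * (2 * CPK))
            * exp (-(μ * ∑ i, (((blk n p i - b' i).natAbs : ℕ) : ℝ))) := h
        _ = _ := by ring
    refine ⟨hwdec, fun b => ?_⟩
    rw [← mul_sub, ← Finset.sum_sub_distrib]
    exact hmean b b' _ (fun q => Ψ q - Ψ₀ q) hwdec

/-! ## §3. Toy -/

/-- Toy (`d = 3`, `a = 1`, `λ = 0`, `Λ = 1`): the three constants exist. -/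
example : ∃ C₀ CP δ₀ : ℝ, 0 < C₀ ∧ 0 < CP ∧ 0 < δ₀ :=
  let ⟨C₀, CP, δ₀, h1, h2, h3, _⟩ := zd_perturbed_coarse_entries (d := 3) le_rfl 1 one_pos (lam := 0) (Lam := 1)
    (by rw [min_eq_right (by norm_num : (1 : ℝ) ≤ 2)]; norm_num) zero_le_one
  ⟨C₀, CP, δ₀, h1, h2, h3⟩

end Summit.QuantumFields.BalabanUV.T4Continuum.NE7b.SupZdPerturbedCoarseEntries
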